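import Summits.ValiantsHypothesis.ValiantsHypothesis.Theorems.OrbitDimensionBound.Negative.FilteredCoveringJordanHolderWitnesses

/-!
# Line `filtered_covering` of crux `OrbitDimensionBound` (stmt-ValiantsHypothesis-16133): audit of the open stub
`stub_jordanHolder` (Jordan–Hölder transport), part 2 — both closedness hypotheses are load-bearing

Negative-lane lemmas (val-neg-1, refuter, 2026-08-28).  The registered OPEN stub `Stmt.stub_jordanHolder` of the workfile
`Cruxes/OrbitDimensionBound/Lines/filtered_covering.lean` reads, with `IsDegeneration` / `IsDegenerationClosed` UNFOLDED as in
part 1 (`FilteredCoveringJordanHolderWitnesses.lean`; definitionally the workfile's text, checked `Iff.rfl`):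

  `∀ n m A A' B P P', (h₁) det A ≠ 0 → (h₂) A ⇝ B → (h₃) A' ⇝ B → (h₄) A ⇝ P → (h₅) P closed → (h₆) A' ⇝ P' →
   (h₇) P' closed → P ∼ P'`   (`⇝` = one-parameter degeneration of any depth, `∼` = constant gauge equivalence).

* `stub_jordanHolder_false_without_closed_left` / `_right` — (h₅) resp. (h₇) CANNOT be dropped: `n = 1`, `m = 2`, the
  non-split pencil `A₀ = [[X, 0], [1, X]]` and the split pencil `X • 1` (`A₀ ⇝ X • 1`; `X • 1` is closed, as every scalar
  pencil is; `A₀ ≁ X • 1` in either direction).  Dropping (h₅): `A = A' = B = P = A₀`, `P' = X • 1`; dropping (h₇):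
  `A = A' = B = P' = A₀`, `P = X • 1`.  So any proof must USE both closedness hypotheses (their module-theoretic content:
  degeneration-closed = semisimple in King's abelian category of `θ`-semistable pencils).

Part 3 (`FilteredCoveringJordanHolderBookkeeping.lean`) records that (h₂), (h₃), (h₄), (h₆) cannot be dropped either; part 1
shows the seven hypotheses are simultaneously satisfiable on a non-degenerate instance.  What is NOT claimed: (h₁) `det A ≠ 0`
is not shown load-bearing — on paper it is removable (an unstable pencil, and then every degeneration of it, degenerates to `0`,
so both closed models are `0`; a semistable pencil needs no determinant): information for the prover, not a defect.  The stub
is believed TRUE (King: degenerations with `Σ a = Σ b` of a `θ`-semistable pencil, `θ = (-1, 1)`, are associated gradeds of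
`θ = 0` filtrations, hence S-equivalent to it; closed = semisimple; S-equivalent semisimples are isomorphic) and is NOT proved
here.  Nothing in this file bears on `OrbitDimensionBound`, `FreeSubtorus` or VP ≠ VNP, which remain OPEN.

## References (orientation only)
* A. D. King, Moduli of representations of finite-dimensional algebras, Quart. J. Math. 45 (1994), Prop. 3.1, Thm. 4.1.
* G. Kempf, L. Ness, The length of vectors in representation spaces, LNM 732 (1979).
-/

namespace Summit.ValiantsHypothesis.Theorems.OrbitDimensionBound.Negative.FilteredCovering

open Matrix MvPolynomial

noncomputable section

/-! ## §5 Load-bearing hypotheses of `stub_jordanHolder` (each dropped hypothesis makes the stub false) -/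

/-- **(h₅) `IsDegenerationClosed P` is load-bearing.**  `stub_jordanHolder` with the closedness of `P` deleted is false:
`n = 1`, `m = 2`, `A = A' = B = P = A₀ = [[X, 0], [1, X]]`, `P' = X • 1` (`A₀ ⇝ X • 1`, `X • 1` closed, but `X • 1` is not
a gauge form of `A₀`). [folklore] -/
theorem stub_jordanHolder_false_without_closed_left :
    ¬ (∀ (n m : ℕ) (A A' B P P' : Matrix (Fin m) (Fin m) (MvPolynomial (Fin n × Fin n) ℂ)),
        A.det ≠ 0 →
        (∃ (g h : GL (Fin m) ℂ) (a b : Fin m → ℕ),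
          (∀ i, (a i : ℕ∞) ≤ ⊤) ∧ (∀ j, (b j : ℕ∞) ≤ ⊤) ∧ ∑ i, a i = ∑ j, b j ∧
          (∀ i j, a i < b j →
            (g.val.map C * A * h.val.map C : Matrix (Fin m) (Fin m) (MvPolynomial (Fin n × Fin n) ℂ)) i j = 0) ∧
          B = Matrix.of fun i j => if a i = b j then
            (g.val.map C * A * h.val.map C : Matrix (Fin m) (Fin m) (MvPolynomial (Fin n × Fin n) ℂ)) i j else 0) →
        (∃ (g h : GL (Fin m) ℂ) (a b : Fin m → ℕ),
          (∀ i, (a i : ℕ∞) ≤ ⊤) ∧ (∀ j, (b j : ℕ∞) ≤ ⊤) ∧ ∑ i, a i = ∑ j, b j ∧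
          (∀ i j, a i < b j →
            (g.val.map C * A' * h.val.map C : Matrix (Fin m) (Fin m) (MvPolynomial (Fin n × Fin n) ℂ)) i j = 0) ∧
          B = Matrix.of fun i j => if a i = b j then
            (g.val.map C * A' * h.val.map C : Matrix (Fin m) (Fin m) (MvPolynomial (Fin n × Fin n) ℂ)) i j else 0) →
        (∃ (g h : GL (Fin m) ℂ) (a b : Fin m → ℕ),
          (∀ i, (a i : ℕ∞) ≤ ⊤) ∧ (∀ j, (b j : ℕ∞) ≤ ⊤) ∧ ∑ i, a i = ∑ j, b j ∧
          (∀ i j, a i < b j →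
            (g.val.map C * A * h.val.map C : Matrix (Fin m) (Fin m) (MvPolynomial (Fin n × Fin n) ℂ)) i j = 0) ∧
          P = Matrix.of fun i j => if a i = b j then
            (g.val.map C * A * h.val.map C : Matrix (Fin m) (Fin m) (MvPolynomial (Fin n × Fin n) ℂ)) i j else 0) →
        (∃ (g h : GL (Fin m) ℂ) (a b : Fin m → ℕ),
          (∀ i, (a i : ℕ∞) ≤ ⊤) ∧ (∀ j, (b j : ℕ∞) ≤ ⊤) ∧ ∑ i, a i = ∑ j, b j ∧
          (∀ i j, a i < b j →
            (g.val.map C * A' * h.val.map C : Matrix (Fin m) (Fin m) (MvPolynomial (Fin n × Fin n) ℂ)) i j = 0) ∧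
          P' = Matrix.of fun i j => if a i = b j then
            (g.val.map C * A' * h.val.map C : Matrix (Fin m) (Fin m) (MvPolynomial (Fin n × Fin n) ℂ)) i j else 0) →
        (∀ B' : Matrix (Fin m) (Fin m) (MvPolynomial (Fin n × Fin n) ℂ),
          (∃ (g h : GL (Fin m) ℂ) (a b : Fin m → ℕ),
            (∀ i, (a i : ℕ∞) ≤ ⊤) ∧ (∀ j, (b j : ℕ∞) ≤ ⊤) ∧ ∑ i, a i = ∑ j, b j ∧
            (∀ i j, a i < b j →
              (g.val.map C * P' * h.val.map C : Matrix (Fin m) (Fin m) (MvPolynomial (Fin n × Fin n) ℂ)) i j = 0) ∧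
            B' = Matrix.of fun i j => if a i = b j then
              (g.val.map C * P' * h.val.map C : Matrix (Fin m) (Fin m) (MvPolynomial (Fin n × Fin n) ℂ)) i j else 0) →
          (∃ (g h : GL (Fin m) ℂ) (a b : Fin m → ℕ),
            (∀ i, (a i : ℕ∞) ≤ 0) ∧ (∀ j, (b j : ℕ∞) ≤ 0) ∧ ∑ i, a i = ∑ j, b j ∧
            (∀ i j, a i < b j →
              (g.val.map C * P' * h.val.map C : Matrix (Fin m) (Fin m) (MvPolynomial (Fin n × Fin n) ℂ)) i j = 0) ∧
            B' = Matrix.of fun i j => if a i = b j then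
              (g.val.map C * P' * h.val.map C : Matrix (Fin m) (Fin m) (MvPolynomial (Fin n × Fin n) ℂ)) i j else 0)) →
        (∃ (g h : GL (Fin m) ℂ) (a b : Fin m → ℕ),
          (∀ i, (a i : ℕ∞) ≤ 0) ∧ (∀ j, (b j : ℕ∞) ≤ 0) ∧ ∑ i, a i = ∑ j, b j ∧
          (∀ i j, a i < b j →
            (g.val.map C * P * h.val.map C : Matrix (Fin m) (Fin m) (MvPolynomial (Fin n × Fin n) ℂ)) i j = 0) ∧
          P' = Matrix.of fun i j => if a i = b j then
            (g.val.map C * P * h.val.map C : Matrix (Fin m) (Fin m) (MvPolynomial (Fin n × Fin n) ℂ)) i j else 0)) := by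
  intro H
  exact jh_toy_not_gauge _ _ rfl rfl (H 1 2
    (!![X (0, 0), 0; 1, X (0, 0)] : Matrix (Fin 2) (Fin 2) (MvPolynomial (Fin 1 × Fin 1) ℂ))
    (!![X (0, 0), 0; 1, X (0, 0)] : Matrix (Fin 2) (Fin 2) (MvPolynomial (Fin 1 × Fin 1) ℂ))
    (!![X (0, 0), 0; 1, X (0, 0)] : Matrix (Fin 2) (Fin 2) (MvPolynomial (Fin 1 × Fin 1) ℂ))
    (!![X (0, 0), 0; 1, X (0, 0)] : Matrix (Fin 2) (Fin 2) (MvPolynomial (Fin 1 × Fin 1) ℂ))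
    ((X (0, 0) : MvPolynomial (Fin 1 × Fin 1) ℂ) • (1 : Matrix (Fin 2) (Fin 2) (MvPolynomial (Fin 1 × Fin 1) ℂ)))
    (jh_toy_det _ rfl) (jh_deg_refl ⊤ _) (jh_deg_refl ⊤ _) (jh_deg_refl ⊤ _) (jh_toy_deg _ _ rfl rfl)
    (jh_scalar_closed _ _ rfl))

/-- **(h₇) `IsDegenerationClosed P'` is load-bearing.**  `stub_jordanHolder` with the closedness of `P'` deleted is false:
`n = 1`, `m = 2`, `A = A' = B = P' = A₀`, `P = X • 1` (`A₀` is not a gauge form of `X • 1`). [folklore] -/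
theorem stub_jordanHolder_false_without_closed_right :
    ¬ (∀ (n m : ℕ) (A A' B P P' : Matrix (Fin m) (Fin m) (MvPolynomial (Fin n × Fin n) ℂ)),
        A.det ≠ 0 →
        (∃ (g h : GL (Fin m) ℂ) (a b : Fin m → ℕ),
          (∀ i, (a i : ℕ∞) ≤ ⊤) ∧ (∀ j, (b j : ℕ∞) ≤ ⊤) ∧ ∑ i, a i = ∑ j, b j ∧
          (∀ i j, a i < b j →
            (g.val.map C * A * h.val.map C : Matrix (Fin m) (Fin m) (MvPolynomial (Fin n × Fin n) ℂ)) i j = 0) ∧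
          B = Matrix.of fun i j => if a i = b j then
            (g.val.map C * A * h.val.map C : Matrix (Fin m) (Fin m) (MvPolynomial (Fin n × Fin n) ℂ)) i j else 0) →
        (∃ (g h : GL (Fin m) ℂ) (a b : Fin m → ℕ),
          (∀ i, (a i : ℕ∞) ≤ ⊤) ∧ (∀ j, (b j : ℕ∞) ≤ ⊤) ∧ ∑ i, a i = ∑ j, b j ∧
          (∀ i j, a i < b j →
            (g.val.map C * A' * h.val.map C : Matrix (Fin m) (Fin m) (MvPolynomial (Fin n × Fin n) ℂ)) i j = 0) ∧
          B = Matrix.of fun i j => if a i = b j then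
            (g.val.map C * A' * h.val.map C : Matrix (Fin m) (Fin m) (MvPolynomial (Fin n × Fin n) ℂ)) i j else 0) →
        (∃ (g h : GL (Fin m) ℂ) (a b : Fin m → ℕ),
          (∀ i, (a i : ℕ∞) ≤ ⊤) ∧ (∀ j, (b j : ℕ∞) ≤ ⊤) ∧ ∑ i, a i = ∑ j, b j ∧
          (∀ i j, a i < b j →
            (g.val.map C * A * h.val.map C : Matrix (Fin m) (Fin m) (MvPolynomial (Fin n × Fin n) ℂ)) i j = 0) ∧
          P = Matrix.of fun i j => if a i = b j then
            (g.val.map C * A * h.val.map C : Matrix (Fin m) (Fin m) (MvPolynomial (Fin n × Fin n) ℂ)) i j else 0) →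
        (∀ B' : Matrix (Fin m) (Fin m) (MvPolynomial (Fin n × Fin n) ℂ),
          (∃ (g h : GL (Fin m) ℂ) (a b : Fin m → ℕ),
            (∀ i, (a i : ℕ∞) ≤ ⊤) ∧ (∀ j, (b j : ℕ∞) ≤ ⊤) ∧ ∑ i, a i = ∑ j, b j ∧
            (∀ i j, a i < b j →
              (g.val.map C * P * h.val.map C : Matrix (Fin m) (Fin m) (MvPolynomial (Fin n × Fin n) ℂ)) i j = 0) ∧
            B' = Matrix.of fun i j => if a i = b j then
              (g.val.map C * P * h.val.map C : Matrix (Fin m) (Fin m) (MvPolynomial (Fin n × Fin n) ℂ)) i j else 0) →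
          (∃ (g h : GL (Fin m) ℂ) (a b : Fin m → ℕ),
            (∀ i, (a i : ℕ∞) ≤ 0) ∧ (∀ j, (b j : ℕ∞) ≤ 0) ∧ ∑ i, a i = ∑ j, b j ∧
            (∀ i j, a i < b j →
              (g.val.map C * P * h.val.map C : Matrix (Fin m) (Fin m) (MvPolynomial (Fin n × Fin n) ℂ)) i j = 0) ∧
            B' = Matrix.of fun i j => if a i = b j then
              (g.val.map C * P * h.val.map C : Matrix (Fin m) (Fin m) (MvPolynomial (Fin n × Fin n) ℂ)) i j else 0)) →
        (∃ (g h : GL (Fin m) ℂ) (a b : Fin m → ℕ),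
          (∀ i, (a i : ℕ∞) ≤ ⊤) ∧ (∀ j, (b j : ℕ∞) ≤ ⊤) ∧ ∑ i, a i = ∑ j, b j ∧
          (∀ i j, a i < b j →
            (g.val.map C * A' * h.val.map C : Matrix (Fin m) (Fin m) (MvPolynomial (Fin n × Fin n) ℂ)) i j = 0) ∧
          P' = Matrix.of fun i j => if a i = b j then
            (g.val.map C * A' * h.val.map C : Matrix (Fin m) (Fin m) (MvPolynomial (Fin n × Fin n) ℂ)) i j else 0) →
        (∃ (g h : GL (Fin m) ℂ) (a b : Fin m → ℕ),
          (∀ i, (a i : ℕ∞) ≤ 0) ∧ (∀ j, (b j : ℕ∞) ≤ 0) ∧ ∑ i, a i = ∑ j, b j ∧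
          (∀ i j, a i < b j →
            (g.val.map C * P * h.val.map C : Matrix (Fin m) (Fin m) (MvPolynomial (Fin n × Fin n) ℂ)) i j = 0) ∧
          P' = Matrix.of fun i j => if a i = b j then
            (g.val.map C * P * h.val.map C : Matrix (Fin m) (Fin m) (MvPolynomial (Fin n × Fin n) ℂ)) i j else 0)) := by
  intro H
  exact jh_toy_not_gauge' _ _ rfl rfl (H 1 2
    (!![X (0, 0), 0; 1, X (0, 0)] : Matrix (Fin 2) (Fin 2) (MvPolynomial (Fin 1 × Fin 1) ℂ))
    (!![X (0, 0), 0; 1, X (0, 0)] : Matrix (Fin 2) (Fin 2) (MvPolynomial (Fin 1 × Fin 1) ℂ))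
    (!![X (0, 0), 0; 1, X (0, 0)] : Matrix (Fin 2) (Fin 2) (MvPolynomial (Fin 1 × Fin 1) ℂ))
    ((X (0, 0) : MvPolynomial (Fin 1 × Fin 1) ℂ) • (1 : Matrix (Fin 2) (Fin 2) (MvPolynomial (Fin 1 × Fin 1) ℂ)))
    (!![X (0, 0), 0; 1, X (0, 0)] : Matrix (Fin 2) (Fin 2) (MvPolynomial (Fin 1 × Fin 1) ℂ))
    (jh_toy_det _ rfl) (jh_deg_refl ⊤ _) (jh_deg_refl ⊤ _) (jh_toy_deg _ _ rfl rfl) (jh_scalar_closed _ _ rfl)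
    (jh_deg_refl ⊤ _))

end

end Summit.ValiantsHypothesis.Theorems.OrbitDimensionBound.Negative.FilteredCovering
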